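import Summits.CriticalPhenomena.PercolationContinuityZ3.Theorems.TallClusterMassBound.Negative.FalseWithoutCriticality
import Summits.CriticalPhenomena.PercolationContinuityZ3.Theorems.BoundaryTwoArmDecay.Negative.LoadBearing
import Summits.CriticalPhenomena.PercolationContinuityZ3.Theorems.PercLowPointHalfSpaceAssemblyReduction
import Literature.Probability.Percolation.TwoPointFunction

/-!
# Crux-ideate sketch, round 2, ideator 5 — crux K `LowPointBookkeeping` (stmt-CriticalPhenomena-14713)

Idea card `vdbhk-tails-alignment-atom` (Cruxes/LowPointBookkeeping/Ideas/).  Statements only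
(`def … : Prop`), no proofs; everything is over existing declarations:
`μ = bondPercolation (zdGraph 3) (criticalProbI 3)`, `H = {x | 0 ≤ x 0}`, `e = Pi.single 1 1`,
`E r` (the verbatim crux-A event) from `BoundaryTwoArmDecay.Negative.{OneArmLowerBound,LoadBearing}`;
`openConnIn`, `box` from the Literature percolation files.

* `VdBHKFatTall` — FIRST LEMMA of the line: van den Berg–Häggström–Kahn 2006, Thm 1.4
  (arXiv:math/0408176: `E[f g | s ↮ t] ≤ E[f | s ↮ t] E[g | s ↮ t]` for bounded increasing `f` of `C_s`,
  `g` of `C_t`), specialised to the half-space graph, `s = 0`, `t = e`, and the increasing cluster events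
  "r-tall and box-mass ≥ m"; written multiplied out (no conditional probabilities).
* `MassTail` — the ONE-cluster input (B♯-type: typical `K_max ≤ C r^{11/4}` + universal tightness):
  exponential tail of the rooted box mass at scale `r^{11/4}`.
* `MinSumLog` — the pure real-analysis step (`Σ_{j,k} 2^{j+k} min(a, b e^{-c(2^j+2^k)}) ≲ a log²(b/a)`).
* `NoFatteningLog` — the lemma the lever delivers: under A (as typed, 5/2+κ), `MassTail` and
  `VdBHKFatTall`, the PRODUCT of the two box masses integrates over the two-arm event `E r` to at most
  `C r^{11/2} · r^{-(5/2+κ)} · log² r` — fattening costs log², not the repulsion factor `1/ρ`.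
* `stacked`, `AlignmentOnTwoArm` — the residual atom (pure alignment of the stacked-pair count on `E r`),
  typed so that a refuter/MC can attack it.
* `sepE`, `SeparationShift` — the rigorous by-product of the vertical-swap analysis
  (A ⇒ root-separation-ℓ two-arm ≤ `C ℓ (1/p_c)^ℓ r^{-(5/2+κ)}`), recorded for the entropy barrier B-ENT.
-/

noncomputable section

open MeasureTheory ProbabilityTheory Filter Topology
open Literature.Probability.Percolation Literature.Probability.LatticeModels
open Summit.CriticalPhenomena.PercolationContinuityZ3.Theses.PercLowPointHalfSpace
open Summit.CriticalPhenomena.PercolationContinuityZ3.Theorems.BoundaryTwoArmDecay.Negative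
  (E H e μ)

namespace Summit.CriticalPhenomena.PercolationContinuityZ3.Cruxes.LowPointBookkeeping.Ideas5

open scoped Classical

/-- `tallAt x r`: the half-space cluster of `x` reaches sup-distance `≥ r` from `x`
(for `x = 0`, `x = e` these are the two arm clauses of `E r`). -/
def tallAt (x : Site 3) (r : ℕ) : Set (BondConfig (Site 3)) :=
  {ω | ∃ y : Site 3, (∃ i : Fin 3, (r : ℤ) ≤ |y i - x i|) ∧ ω ∈ openConnIn H x y}

/-- `massAt x r ω = |C_ℍ(x) ∩ (x + B_r)|`, the rooted box mass (an increasing function of the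
cluster of `x`). -/
def massAt (x : Site 3) (r : ℕ) (ω : BondConfig (Site 3)) : ℕ :=
  ((box 3 r).filter fun z => ω ∈ openConnIn H x (x + z)).card

/-- The disjointness clause of crux A: `0 ↮_ℍ e` (a decreasing event). -/
def Dis : Set (BondConfig (Site 3)) := (openConnIn H (0 : Site 3) e)ᶜ

/-- "r-tall and fat": `C_ℍ(x)` reaches sup-distance `r` and has box mass `≥ m` — increasing and
determined by the open cluster of `x` in the sense of vdBHK. -/
def FatTall (x : Site 3) (r m : ℕ) : Set (BondConfig (Site 3)) :=
  tallAt x r ∩ {ω | m ≤ massAt x r ω}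

/-- **FIRST LEMMA (van den Berg–Häggström–Kahn 2006, Thm 1.4, specialised).**  Conditioned on
`0 ↮_ℍ e`, the increasing cluster events `FatTall 0 r m` (of `C_ℍ(0)`) and `FatTall e r m'` (of `C_ℍ(e)`)
are negatively correlated: `P(F₀ ∩ F_e ∩ D) · P(D) ≤ P(F₀ ∩ D) · P(F_e ∩ D)`.  Printed for arbitrary
(locally finite, via the finite-volume limit) graphs; here the graph is the induced half-space graph of
`ℤ³`, on which `openConnIn H` is connectivity. -/
def VdBHKFatTall : Prop :=
  ∀ r m m' : ℕ,
    μ.real (FatTall 0 r m ∩ FatTall e r m' ∩ Dis) * μ.real Dis ≤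
      μ.real (FatTall 0 r m ∩ Dis) * μ.real (FatTall e r m' ∩ Dis)

/-- **One-cluster input `MassTail` (B♯-type).**  The rooted box mass has an exponential tail at scale
`r^{11/4}`: `P(|C_ℍ(0) ∩ B_r| ≥ t·r^{11/4}) ≤ C e^{-c t}` for `t ≥ 1`, `r ≥ 1`.  (Implied by "typical
`K_max(B_r ∩ ℍ) ≤ C r^{11/4}`" = the line's B♯ plus universal tightness; implies B up to a constant.) -/
def MassTail : Prop :=
  ∃ c C : ℝ, 0 < c ∧ ∀ r : ℕ, 1 ≤ r → ∀ t : ℝ, 1 ≤ t →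
    μ.real {ω | t * (r : ℝ) ^ ((11 : ℝ) / 4) ≤ (massAt 0 r ω : ℝ)} ≤ C * Real.exp (-c * t)

/-- **Pure real-analysis step.**  For `0 < a ≤ b`: `Σ_{j,k<J} 2^{j+k} min(a, b·e^{-c(2^j+2^k)}) ≤ K·a·(1 + log(b/a))²`
with `K` depending on `c` only (the small terms are capped by `a` up to `2^j,2^k ≲ log(b/a)`, the rest is a
convergent double exponential tail). -/
def MinSumLog : Prop :=
  ∀ c : ℝ, 0 < c → ∃ K : ℝ, ∀ a b : ℝ, 0 < a → a ≤ b → ∀ J : ℕ,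
    (∑ j ∈ Finset.range J, ∑ k ∈ Finset.range J,
        (2 : ℝ) ^ (j + k) * min a (b * Real.exp (-c * ((2 : ℝ) ^ j + (2 : ℝ) ^ k)))) ≤
      K * a * (1 + Real.log (b / a)) ^ 2

/-- **The lever's output `NoFatteningLog`.**  Under crux A AS TYPED (exponent `5/2+κ`, roots adjacent,
floor density `p_c`), `MassTail` and the vdBHK inequality, the product of the two rooted box masses does
not fatten on the two-arm event beyond `log² r`:
`∫_{E r} |C_ℍ(0)∩B_r|·|C_ℍ(e)∩(e+B_r)| dP ≤ C · r^{11/2} · r^{-(5/2+κ)} · (log r)²`.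
(Proof plan: dyadic level sets of both masses; each joint tail event on `E r` has probability
`≤ min(P(E r), P(F₀∩D)P(F_e∩D)/P(D)²)` by `VdBHKFatTall`; `MassTail` and `P(D) ≥ (1-p_c)^6` bound the
second entry by `C e^{-c(2^j+2^k)}`; `MinSumLog` sums.) -/
def NoFatteningLog : Prop :=
  ∀ κ C₀ : ℝ, 0 < κ →
    (∀ r : ℕ, 1 ≤ r → μ.real (E r) ≤ C₀ * (r : ℝ) ^ (-(5 / 2 + κ))) →
    MassTail → VdBHKFatTall →
      ∃ C : ℝ, ∀ r : ℕ, 2 ≤ r →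
        ∫ ω in E r, ((massAt 0 r ω : ℝ) * (massAt e r ω : ℝ)) ∂μ ≤
          C * (r : ℝ) ^ ((11 : ℝ) / 2 - (5 / 2 + κ)) * (Real.log r) ^ 2

/-- The **stacked-pair count** at vertical offset `n`: points `v ∈ B_r` of `C_ℍ(0)` with `v + n e₀ ∈ C_ℍ(e)`
(the bilinear functional the bookkeeping actually needs on the two-arm event). -/
def stacked (n r : ℕ) (ω : BondConfig (Site 3)) : ℕ :=
  ((box 3 r).filter fun v =>
      ω ∈ openConnIn H (0 : Site 3) v ∧ ω ∈ openConnIn H e (v + Pi.single 0 (n : ℤ))).card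

/-- **The residual atom `AlignmentOnTwoArm` (two-cluster, pure alignment).**  On the adjacent-root
two-arm event the stacked-pair count is at most (mass) × (density) up to polylog:
`∫_{E r} stacked(n,r) dP ≤ C r^{11/4 − 1/4} (1 + log r)^q P(E r)` for all `n, r`.  With tails alone one
only gets `r^{11/4}` (a loss of exactly `r^{1/4} = r^{d-m}`), which is why the restatement of record raises
A's exponent from `2m−3 = 5/2` to `m = 11/4`.  Irrefutable today (no lower bounds on two-arm functionals);
MC-measurable (ratio `stacked·r³/(mass·windowmass)` on `E r` samples). -/
def AlignmentOnTwoArm : Prop :=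
  ∃ C q : ℝ, ∀ n r : ℕ, 1 ≤ r →
    ∫ ω in E r, (stacked n r ω : ℝ) ∂μ ≤
      C * (r : ℝ) ^ ((5 : ℝ) / 2) * (1 + Real.log r) ^ q * μ.real (E r)

/-- Root-separated two-arm event: disjoint `r`-tall half-space clusters from `0` and `b`. -/
def sepE (b : Site 3) (r : ℕ) : Set (BondConfig (Site 3)) :=
  tallAt 0 r ∩ tallAt b r ∩ (openConnIn H (0 : Site 3) b)ᶜ

/-- **By-product of the swap analysis (`SeparationShift`, rigorous content of barrier note B-ENT).**
A measure-preserving swap of the floor edges under a level-1 bridge with the bridge itself turns a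
separation-`ℓ` pair into the adjacent-root event at cost `(1/p_c)` per bridged edge and no multiplicity:
A ⇒ `P(sepE (ℓ e) r) ≤ C ℓ (1/p_c)^ℓ r^{-(5/2+κ)}`.  Exponential in `ℓ` — and `(1/p_c)·e^{-1/ξ_floor} > 1`, so
this cannot pay for floor-glued bush pairs at separation `≳ log r` (the entropy barrier). -/
def SeparationShift : Prop :=
  BoundaryTwoArmDecay →
    ∃ κ C : ℝ, 0 < κ ∧ ∀ ℓ : ℕ, 1 ≤ ℓ → ∀ r : ℕ, 1 ≤ r →
      μ.real (sepE (Pi.single 1 (ℓ : ℤ)) r) ≤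
        C * ℓ * ((criticalProbI 3 : ℝ)⁻¹) ^ ℓ * (r : ℝ) ^ (-(5 / 2 + κ))

/-- Sanity: the crux-A event is the adjacent case `b = e` of `sepE` (both are literally
"two arms and `0 ↮_ℍ b`"; `e i` vs `Pi.single 1 1 i`). -/
theorem sepE_e_eq_E (r : ℕ) : sepE e r = E r := by
  ext ω
  simp only [sepE, E, tallAt, Set.mem_inter_iff, Set.mem_setOf_eq, Set.mem_compl_iff, sub_zero,
    Pi.zero_apply]
  tauto

end Summit.CriticalPhenomena.PercolationContinuityZ3.Cruxes.LowPointBookkeeping.Ideas5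

end
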